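import Literature.NumberTheory.EllipticCurves.BSDSelmerPConverse
import Literature.NumberTheory.EllipticCurves.GaloisActionProofs
import Literature.NumberTheory.EllipticCurves.WeilPairingProofs
import Literature.NumberTheory.EllipticCurves.DeligneSerreWeightOneIrreducibleKroneckerWeberProofs
import Literature.NumberTheory.GaloisRepresentations.SerreSL2Lifting
import Mathlib.Data.ZMod.QuotientGroup
import HarnessLib

/-!
# Serre's lifting lemma for the image of Galois on `E[p^n]`: discharge of
# `serre_hasSurjectiveModNGaloisRep_pow`

Family `bsd`, companion to `Literature.NumberTheory.EllipticCurves.BSDSelmerPConverse` (bsd.S25),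
whose named fact `serre_hasSurjectiveModNGaloisRep_pow` — for an elliptic curve `W/ℚ` and a prime
`p ≥ 5`, `ρ̄_{E,p} : Γ_ℚ → Aut(E[p])` onto ⟹ `ρ̄_{E,p^n} : Γ_ℚ → Aut(E[p^n])` onto for every `n`
(J.-P. Serre, *Abelian `ℓ`-adic representations and elliptic curves* (1968), Ch. IV §3.4,
Lemma 3, as applied to `ρ_{E,p}`; quoted there from Dokchitser–Dokchitser, Math. Z. 272 (2012),
Introduction) — is PROVED here, unconditionally: `serre_hasSurjectiveModNGaloisRep_pow_holds`.
It is a leaf of the assemblies `analyticRank_eq_one_of_selmerCorank_eq_one_of_facts`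
(`BSDSelmerPConverse`) and
`burungaleSkinnerTianWan_analyticRank_eq_one_of_selmerCorank_eq_one_of_facts`
(`BSDSelmerPConverseProofs`) of Burungale–Skinner–Tian–Wan, arXiv:2409.01350, Thm. 1.10.

## Proof

For `n = 0`, `E[1] = 0`. For `n = k + 1`:
* `E[p^n] ≅ (ℤ/p^n ℤ)²` (`nonempty_addEquiv_geomTorsion`): from `#E[p^n] = p^{2n}` and
  `#E[p] = p²` (tree theorem `WeierstrassCurve.card_torsionPoints_eq_sq_holds`, Silverman *AEC*
  III.6.4(b)) by the elementary `nonempty_addEquiv_of_card_eq` (a finite abelian group `M` killed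
  by `p^n` with `#M = p^{2n}`, `#M[p] = p²` is `(ℤ/p^n)²`: `#(M/pM) = #M[p] = p²`, so two elements
  generate `M` modulo `pM` (`exists_pair_forall_eq_zsmul_add_zsmul`), hence modulo `p^n M = 0`);
* a frame `e` turns the Galois action into `ρ : Γ_ℚ → GL₂(ℤ/p^n)` with `e(σP) = ρ(σ) e(P)`
  (`exists_rep_of_addEquiv`, via `exists_matrix_of_addEquiv`);
* `det ρ(σ) = χ_{p^n}(σ)` (`det_eq_modNCyclotomicCharacter`, for every level `m ≥ 2` invertible in
  a perfect field: the tree's mod-`p` argument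
  `det_eq_modPCyclotomicCharacterZMod_of_exists_weilPairing` with the extra remark that
  `ζ = e_m(P, Q)` is a *primitive* `m`-th root of unity by non-degeneracy; the Weil pairing is
  the tree theorem `WeierstrassCurve.exists_weilPairing_holds`, Silverman *AEC* III.8.1), and
  `χ_{p^n} : Γ_ℚ → (ℤ/p^n)ˣ` is onto (tree theorem
  `GaloisRepresentations.modNCyclotomicCharacter_rat_surjective`);
* reduction: `E[p] = p^k E[p^{k+1}]`, so the surjectivity of `ρ̄_{E,p}` says that the image
  `H = ρ(Γ_ℚ) ≤ GL₂(ℤ/p^n)` maps onto `GL₂(𝔽_p)` (`exists_map_eq_of_hasSurjectiveModNGaloisRep`: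
  `v ↦ e⁻¹(p^k ṽ)` is a `Γ_ℚ`-equivariant bijection `𝔽_p² ≅ E[p]`);
* Serre's lemma at level `p^n`
  (`GaloisRepresentations.Serre1968.generalLinearGroup_eq_top_of_map_surjective`, `p ≥ 5`):
  `H = GL₂(ℤ/p^n)`; so every additive automorphism of `E[p^n]`, having an invertible
  matrix (`exists_generalLinearGroup_of_addEquiv`), is `ρ̄_{E,p^n}(σ)` for some `σ`.

## Design notes

* Theorems only (no definitions, no named facts); everything over a general field `F` with
  `(p : F) ≠ 0` except the two inputs specific to `ℚ` (surjectivity of `χ_{p^n}`, and the fact's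
  own statement).
* The structure lemma `nonempty_addEquiv_of_card_eq` is proved by counting in `M/pM` with
  `AddSubgroup.closure` of two elements rather than by linear algebra over `𝔽_p` (no `Module`
  structure is put on the torsion groups; frames are additive isomorphisms `≃+ (Fin 2 → ZMod m)`,
  as in `WeilPairing` and `BCDTModularity`).
* `Literature.NumberTheory.EllipticCurves.DeligneSerreWeightOneIrreducibleKroneckerWeberProofs` is
  imported only for `modNCyclotomicCharacter_rat_surjective` (not restated).

## References

* [SerreAbelianLadic1968] J.-P. Serre, *Abelian `ℓ`-adic representations and elliptic curves*
  (1968), Ch. IV §3.4, Lemma 3 (finite level: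
  `Literature/NumberTheory/GaloisRepresentations/SerreSL2Lifting.lean`).
* [SilvermanCSS1997] J. H. Silverman, in Cornell–Silverman–Stevens, *Modular Forms and Fermat's
  Last Theorem* (1997), Ch. II §7 (Proposition: `det ρ̄_m = χ_m`) and §8 (Weil pairing).
* [SilvermanAEC2009] J. H. Silverman, *The Arithmetic of Elliptic Curves*, III.6.4, III.7, III.8.
* [Lang1987] S. Lang, *Elliptic Functions* (1987), Ch. 17 §4.
-/

noncomputable section

open scoped Classical MatrixGroups

open WeierstrassCurve Matrix

universe u

namespace Literature.NumberTheory.EllipticCurves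

/-! ### Abelian groups of order `p^{2n}` killed by `p^n` with `p`-torsion of order `p²` -/

section Structure

open QuotientAddGroup

/-- In an elementary abelian `p`-group of order `p²`, two elements `q₀ ≠ 0`, `q₁ ∉ ⟨q₀⟩` generate,
so every element is `m q₀ + n q₁`. [folklore] -/
theorem exists_pair_forall_eq_zsmul_add_zsmul {Q : Type*} [AddCommGroup Q] {p : ℕ} [Fact p.Prime]
    (hQ : ∀ q : Q, p • q = 0) (hcard : Nat.card Q = p ^ 2) :
    ∃ q₀ q₁ : Q, ∀ q : Q, ∃ m n : ℤ, q = m • q₀ + n • q₁ := by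
  have hp : p.Prime := Fact.out
  haveI : Finite Q := Nat.finite_of_card_ne_zero (by rw [hcard]; exact pow_ne_zero _ hp.ne_zero)
  -- a nonzero element `q₀`, of order `p`
  have hnt : Nontrivial Q := by
    rw [← Finite.one_lt_card_iff_nontrivial, hcard]
    exact Nat.one_lt_pow two_ne_zero hp.one_lt
  obtain ⟨q₀, hq₀⟩ := exists_ne (0 : Q)
  have hord : addOrderOf q₀ = p := addOrderOf_eq_prime (hQ q₀) hq₀
  have hcard₀ : Nat.card (AddSubgroup.zmultiples q₀) = p := by rw [Nat.card_zmultiples, hord]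
  -- an element `q₁` outside `⟨q₀⟩`
  have hne : AddSubgroup.zmultiples q₀ ≠ ⊤ := by
    intro h
    have := hcard₀
    rw [h, AddSubgroup.card_top, hcard] at this
    exact absurd this (by
      have : p < p ^ 2 := lt_self_pow₀ hp.one_lt (by norm_num)
      omega)
  obtain ⟨q₁, hq₁⟩ : ∃ q₁ : Q, q₁ ∉ AddSubgroup.zmultiples q₀ := by
    rw [Ne, AddSubgroup.eq_top_iff', not_forall] at hne
    exact hne
  -- the subgroup generated by `q₀, q₁` is everything
  set H := AddSubgroup.closure ({q₀, q₁} : Set Q) with hH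
  have hle : AddSubgroup.zmultiples q₀ ≤ H := by
    rw [AddSubgroup.zmultiples_eq_closure]
    exact AddSubgroup.closure_mono (Set.singleton_subset_iff.mpr (Set.mem_insert _ _))
  have hq₁H : q₁ ∈ H := AddSubgroup.subset_closure (Set.mem_insert_of_mem _ (Set.mem_singleton _))
  have hHtop : H = ⊤ := by
    apply AddSubgroup.eq_top_of_card_eq
    obtain ⟨i, hi, hHi⟩ :=
      (Nat.dvd_prime_pow hp).mp (hcard ▸ AddSubgroup.card_addSubgroup_dvd_card H)
    have hpdvd : p ∣ Nat.card H := hcard₀ ▸ AddSubgroup.card_dvd_of_le hle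
    rw [hHi] at hpdvd ⊢
    rw [hcard]
    have hi1 : i ≠ 0 := by
      rintro rfl
      rw [pow_zero, Nat.dvd_one] at hpdvd
      exact hp.one_lt.ne' hpdvd
    have hi2 : i ≠ 1 := by
      rintro rfl
      apply hq₁
      have hEq : AddSubgroup.zmultiples q₀ = H :=
        AddSubgroup.eq_of_le_of_card_ge hle (by rw [hHi, hcard₀, pow_one])
      rw [hEq]
      exact hq₁H
    obtain rfl : i = 2 := by omega
    rfl
  refine ⟨q₀, q₁, fun q ↦ ?_⟩
  have hq : q ∈ H := hHtop ▸ AddSubgroup.mem_top q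
  obtain ⟨m, n, h⟩ := AddSubgroup.mem_closure_pair.mp hq
  exact ⟨m, n, h.symm⟩

/-- **A finite abelian group killed by `p^n`, of order `p^{2n}`, whose `p`-torsion has order `p²`,
is `(ℤ/p^n ℤ)²`.** (Structure of `E[p^n]` from `#E[p^n] = p^{2n}` and `#E[p] = p²`; proof: with
`Q = M/pM`, `#Q = #M[p] = p²`, so two elements of `M` generate `M` modulo `pM`
(`exists_pair_forall_eq_zsmul_add_zsmul`); then `M = ⟨v₀, v₁⟩ + pM = … = ⟨v₀, v₁⟩ + p^n M =
⟨v₀, v₁⟩`, and `(ℤ/p^n)² → M` is onto between sets of the same size.) [folklore] -/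
theorem nonempty_addEquiv_of_card_eq {M : Type*} [AddCommGroup M] {p n : ℕ} [Fact p.Prime]
    (hM : ∀ x : M, (p ^ n) • x = 0) (hcard : Nat.card M = p ^ (2 * n))
    (hker : Nat.card {x : M // p • x = 0} = p ^ 2) :
    Nonempty (M ≃+ (Fin 2 → ZMod (p ^ n))) := by
  classical
  have hp : p.Prime := Fact.out
  haveI : NeZero p := ⟨hp.ne_zero⟩
  haveI : Finite M := Nat.finite_of_card_ne_zero (by rw [hcard]; exact pow_ne_zero _ hp.ne_zero)
  -- multiplication by `p`, its kernel `M[p]` and its image `pM`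
  set φ : M →+ M := DistribSMul.toAddMonoidHom M p with hφ
  have hφ_apply : ∀ x, φ x = p • x := fun x ↦ rfl
  set S : AddSubgroup M := φ.range with hS
  -- `#(M/pM) = #M[p] = p²`
  have hkercard : Nat.card φ.ker = p ^ 2 := by
    rw [← hker]
    exact Nat.card_congr (Equiv.subtypeEquivRight fun x ↦ by rw [AddMonoidHom.mem_ker, hφ_apply])
  have hQcard : Nat.card (M ⧸ S) = p ^ 2 := by
    have h1 : Nat.card M = Nat.card (M ⧸ S) * Nat.card S :=
      AddSubgroup.card_eq_card_quotient_mul_card_addSubgroup S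
    have h2 : Nat.card M = Nat.card (M ⧸ φ.ker) * Nat.card φ.ker :=
      AddSubgroup.card_eq_card_quotient_mul_card_addSubgroup φ.ker
    have h3 : Nat.card (M ⧸ φ.ker) = Nat.card S :=
      Nat.card_congr (QuotientAddGroup.quotientKerEquivRange φ).toEquiv
    have hSpos : 0 < Nat.card S := Nat.card_pos
    rw [h3, mul_comm] at h2
    rw [← hkercard]
    exact Nat.eq_of_mul_eq_mul_right hSpos (h1.symm.trans h2)
  -- `Q = M/pM` is killed by `p`; two generators, lifted to `v₀, v₁ ∈ M`
  have hQp : ∀ q : M ⧸ S, p • q = 0 := by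
    intro q
    obtain ⟨x, rfl⟩ := QuotientAddGroup.mk_surjective q
    rw [← QuotientAddGroup.mk_nsmul, QuotientAddGroup.eq_zero_iff]
    exact ⟨x, rfl⟩
  obtain ⟨b₀, b₁, hb⟩ := exists_pair_forall_eq_zsmul_add_zsmul hQp hQcard
  obtain ⟨v₀, hv₀⟩ := QuotientAddGroup.mk_surjective b₀
  obtain ⟨v₁, hv₁⟩ := QuotientAddGroup.mk_surjective b₁
  set v : Fin 2 → M := ![v₀, v₁] with hv
  -- the map `(ℤ/p^n)² → M`, `c ↦ c₀ v₀ + c₁ v₁`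
  have hvz : ∀ i, (zmultiplesHom M (v i)) (p ^ n : ℕ) = 0 := fun i ↦ by
    rw [zmultiplesHom_apply, natCast_zsmul, hM]
  let L : Fin 2 → (ZMod (p ^ n) →+ M) := fun i ↦ ZMod.lift (p ^ n) ⟨zmultiplesHom M (v i), hvz i⟩
  have hL : ∀ i (k : ℤ), L i (k : ZMod (p ^ n)) = k • v i := fun i k ↦ by
    simp only [L]
    rw [ZMod.lift_coe]
    rfl
  let ψ : (Fin 2 → ZMod (p ^ n)) →+ M :=
    (L 0).comp (Pi.evalAddMonoidHom _ 0) + (L 1).comp (Pi.evalAddMonoidHom _ 1)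
  have hψ : ∀ c, ψ c = L 0 (c 0) + L 1 (c 1) := fun c ↦ rfl
  -- every `x` is `ψ c` modulo `pM`
  have hstep : ∀ x : M, ∃ c y, x = ψ c + p • y := by
    intro x
    obtain ⟨m, k, hmk⟩ := hb (QuotientAddGroup.mk x)
    have hx : (QuotientAddGroup.mk x : M ⧸ S) =
        QuotientAddGroup.mk (ψ ![(m : ZMod (p ^ n)), k]) := by
      rw [hmk, hψ, ← hv₀, ← hv₁]
      simp only [Matrix.cons_val_zero, Matrix.cons_val_one, hL, hv, QuotientAddGroup.mk_add,
        QuotientAddGroup.mk_zsmul]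
    rw [QuotientAddGroup.eq] at hx
    obtain ⟨y, hy⟩ := hx
    refine ⟨![(m : ZMod (p ^ n)), k], -y, ?_⟩
    rw [hφ_apply] at hy
    rw [smul_neg, hy]
    abel
  -- iterate: every `x` is `ψ c` modulo `p^k M`, for every `k`
  have hiter : ∀ (k : ℕ) (x : M), ∃ c y, x = ψ c + (p ^ k) • y := by
    intro k
    induction k with
    | zero => exact fun x ↦ ⟨0, x, by rw [map_zero, zero_add, pow_zero, one_smul]⟩
    | succ k ih =>
      intro x
      obtain ⟨c, y, rfl⟩ := ih x
      obtain ⟨c', y', rfl⟩ := hstep y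
      refine ⟨c + (p ^ k) • c', y', ?_⟩
      rw [map_add, map_nsmul, smul_add, pow_succ, mul_smul]
      abel
  have hsurj : Function.Surjective ψ := fun x ↦ by
    obtain ⟨c, y, h⟩ := hiter n x
    exact ⟨c, by rw [h, hM, add_zero]⟩
  have hbij : Function.Bijective ψ := hsurj.bijective_of_nat_card_le (by
    rw [hcard, Nat.card_fun, Nat.card_zmod, Nat.card_eq_fintype_card, Fintype.card_fin, ← pow_mul,
      mul_comm])
  exact ⟨(AddEquiv.ofBijective ψ hbij).symm⟩

end Structure

/-! ### Matrices of additive endomorphisms in a frame -/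

/-- Given a frame `e : M ≃ (ℤ/m)²` of an abelian group, every additive endomorphism `f` of `M` has
a matrix `Φ f` (`e (f P) = Φ f · e P`), multiplicatively in `f`. [folklore] -/
theorem exists_matrix_of_addEquiv {M : Type*} [AddCommGroup M] {m : ℕ}
    (e : M ≃+ (Fin 2 → ZMod m)) :
    ∃ Φ : AddMonoid.End M →* Matrix (Fin 2) (Fin 2) (ZMod m),
      ∀ (f : M →+ M) (P : M), e (f P) = Φ f *ᵥ e P := by
  let conj : AddMonoid.End M → ((Fin 2 → ZMod m) →ₗ[ZMod m] (Fin 2 → ZMod m)) := fun f ↦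
    (e.toAddMonoidHom.comp ((f : M →+ M).comp e.symm.toAddMonoidHom)).toZModLinearMap m
  have hconj : ∀ (f : AddMonoid.End M) (v : Fin 2 → ZMod m), conj f v = e (f (e.symm v)) :=
    fun f v ↦ rfl
  refine ⟨{ toFun := fun f ↦ LinearMap.toMatrix' (conj f)
            map_one' := ?_
            map_mul' := ?_ }, fun f P ↦ ?_⟩
  · have : conj 1 = LinearMap.id := LinearMap.ext fun v ↦ by
      rw [hconj, AddMonoid.End.coe_one, id_eq, e.apply_symm_apply, LinearMap.id_apply]
    simp only [this, LinearMap.toMatrix'_id]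
  · intro f g
    have : conj (f * g) = (conj f).comp (conj g) := LinearMap.ext fun v ↦ by
      rw [LinearMap.comp_apply, hconj, hconj, hconj, AddMonoid.End.coe_mul, Function.comp_apply,
        e.symm_apply_apply]
    simp only [this, LinearMap.toMatrix'_comp]
  · change e (f P) = LinearMap.toMatrix' (conj f) *ᵥ e P
    rw [LinearMap.toMatrix'_mulVec, hconj, e.symm_apply_apply]
    rfl

/-- The matrix of an additive automorphism in a frame is invertible. [folklore] -/
theorem exists_generalLinearGroup_of_addEquiv {M : Type*} [AddCommGroup M] {m : ℕ}
    (Φ : AddMonoid.End M →* Matrix (Fin 2) (Fin 2) (ZMod m)) (f : M ≃+ M) :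
    ∃ B : GL (Fin 2) (ZMod m), (B : Matrix (Fin 2) (Fin 2) (ZMod m)) = Φ (f : M →+ M) := by
  set a : AddMonoid.End M := (f : M →+ M) with ha
  set b : AddMonoid.End M := (f.symm : M →+ M) with hb
  have h1 : a * b = 1 := AddMonoidHom.ext fun x ↦ f.apply_symm_apply x
  have h2 : b * a = 1 := AddMonoidHom.ext fun x ↦ f.symm_apply_apply x
  exact ⟨⟨Φ a, Φ b, by rw [← map_mul, h1, map_one], by rw [← map_mul, h2, map_one]⟩, rfl⟩

/-! ### The matrix representation of `Γ_F` on `E[m]` attached to a frame -/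

/-- Given a frame `e : E[m] ≃ (ℤ/m)²`, the Galois action on `E[m]` is a homomorphism
`ρ : Γ_F → GL₂(ℤ/m)` with `e (σ P) = ρ(σ) · e P` (the framed mod-`m` representation,
Silverman *AEC* III.7). [folklore] -/
theorem exists_rep_of_addEquiv {F : Type u} [Field F] (W : WeierstrassCurve F) {m : ℕ}
    (e : geomTorsion W m ≃+ (Fin 2 → ZMod m)) :
    ∃ ρ : Field.absoluteGaloisGroup F →* GL (Fin 2) (ZMod m),
      ∀ (σ : Field.absoluteGaloisGroup F) (P : geomTorsion W m),
        e (σ • P) = ((ρ σ : GL (Fin 2) (ZMod m)) : Matrix (Fin 2) (Fin 2) (ZMod m)) *ᵥ e P := by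
  obtain ⟨Φ, hΦ⟩ := exists_matrix_of_addEquiv e
  refine ⟨(Φ.comp (DistribMulAction.toAddMonoidEnd (Field.absoluteGaloisGroup F)
    (geomTorsion W m))).toHomUnits, fun σ P ↦ ?_⟩
  rw [MonoidHom.coe_toHomUnits, MonoidHom.comp_apply, DistribMulAction.toAddMonoidEnd_apply]
  exact hΦ (DistribSMul.toAddMonoidHom _ σ) P

/-! ### A frame of `E[p^n]` -/

/-- **`E[p^n] ≅ (ℤ/p^n ℤ)²`** for an elliptic curve over a field of characteristic `≠ p` and
`n ≥ 1` (Silverman, *AEC* III.6.4(b)), from `#E[p^n] = p^{2n}` and `#E[p] = p²`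
(`card_torsionPoints_eq_sq_holds`) by `nonempty_addEquiv_of_card_eq`. [folklore] -/
theorem nonempty_addEquiv_geomTorsion {F : Type u} [Field F] (W : WeierstrassCurve F)
    [W.IsElliptic] (p n : ℕ) [Fact p.Prime] (hn : 1 ≤ n) (hpF : (p : F) ≠ 0) :
    Nonempty (geomTorsion W ((p ^ n : ℕ) : ℤ) ≃+ (Fin 2 → ZMod (p ^ n))) := by
  obtain ⟨k, rfl⟩ : ∃ k, n = k + 1 := ⟨n - 1, by omega⟩
  have hpF' : ((p : ℕ) : AlgebraicClosure F) ≠ 0 := fun h0 ↦ hpF <| by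
    apply (algebraMap F (AlgebraicClosure F)).injective
    rw [map_natCast, map_zero, h0]
  have hcardN : Nat.card (geomTorsion W ((p ^ (k + 1) : ℕ) : ℤ)) = p ^ (2 * (k + 1)) := by
    have h : Nat.card (geomTorsion W ((p ^ (k + 1) : ℕ) : ℤ)) = (p ^ (k + 1)) ^ 2 :=
      card_torsionPoints_eq_sq_holds W (AlgebraicClosure F) (n := p ^ (k + 1))
        (by rw [Nat.cast_pow]; exact pow_ne_zero _ hpF')
    rw [← pow_mul, mul_comm] at h
    exact h
  have hcard1 : Nat.card (geomTorsion W (p : ℤ)) = p ^ 2 :=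
    card_torsionPoints_eq_sq_holds W (AlgebraicClosure F) hpF'
  refine nonempty_addEquiv_of_card_eq (fun x ↦ AddSubgroup.torsionBy.nsmul x) hcardN ?_
  rw [← hcard1]
  have mem1 : ∀ x : {x : geomTorsion W ((p ^ (k + 1) : ℕ) : ℤ) // p • x = 0},
      ((x.1 : geomTorsion W ((p ^ (k + 1) : ℕ) : ℤ)) : geomPoints W) ∈ geomTorsion W (p : ℤ) := by
    intro x
    rw [AddSubgroup.torsionBy.nsmul_iff, ← AddSubmonoidClass.coe_nsmul, x.2]
    rfl
  have mem2 : ∀ P : geomTorsion W (p : ℤ),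
      (P : geomPoints W) ∈ geomTorsion W ((p ^ (k + 1) : ℕ) : ℤ) := by
    intro P
    rw [AddSubgroup.torsionBy.nsmul_iff, pow_succ, mul_smul,
      AddSubgroup.torsionBy.nsmul_iff.mp P.2, smul_zero]
  have mem3 : ∀ P : geomTorsion W (p : ℤ),
      p • (⟨(P : geomPoints W), mem2 P⟩ : geomTorsion W ((p ^ (k + 1) : ℕ) : ℤ)) = 0 := by
    intro P
    apply Subtype.ext
    rw [AddSubmonoidClass.coe_nsmul]
    exact AddSubgroup.torsionBy.nsmul_iff.mp P.2
  exact Nat.card_congr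
    { toFun := fun x ↦ ⟨_, mem1 x⟩
      invFun := fun P ↦ ⟨⟨(P : geomPoints W), mem2 P⟩, mem3 P⟩
      left_inv := fun x ↦ rfl
      right_inv := fun P ↦ rfl }


/-! ### `det ρ̄_{E,m} = χ_m` from the Weil pairing, for every level `m` -/

/-- **`det ρ̄_{E,m} = χ_m`** for every `m ≥ 2` invertible in the perfect field `F` (Silverman, in
Cornell–Silverman–Stevens, Ch. II §7 Proposition and §8; *AEC* III.8): the tree's
`det_eq_modPCyclotomicCharacterZMod_of_exists_weilPairing` (prime level) verbatim, except that
the value `ζ = e_m(P, Q)` on a `ℤ/m`-basis `P, Q` of `E[m]` is shown to be a *primitive* `m`-th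
root of unity (if `ζ^d = 1` then `e_m(S, dQ) = 1` for all `S`, so `dQ = 0` by non-degeneracy,
so `m ∣ d`), and the Weil pairing is supplied by `exists_weilPairing_holds`.
[cite: SilvermanCSS1997, Ch. II §7 Proposition and §8] -/
theorem det_eq_modNCyclotomicCharacter {F : Type u} [Field F] [PerfectField F]
    (W : WeierstrassCurve F) [W.IsElliptic] (m : ℕ) [NeZero m] [NeZero (m : F)] (hm : 2 ≤ m)
    (e : geomTorsion W m ≃+ (Fin 2 → ZMod m)) (σ : Field.absoluteGaloisGroup F)
    (M : Matrix (Fin 2) (Fin 2) (ZMod m))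
    (hM : ∀ P : geomTorsion W m, e (σ • P) = M.mulVec (e P)) :
    M.det = ((GaloisRepresentations.modNCyclotomicCharacter F m σ : (ZMod m)ˣ) : ZMod m) := by
  have hm0 : m ≠ 0 := NeZero.ne m
  obtain ⟨w, hpow, haddl, haddr, halt, hnd, hgal⟩ :=
    exists_weilPairing_holds W m hm (NeZero.ne (m : F))
  -- values are nonzero; `w 0 T = 1`, `w S 0 = 1`; `w (a • S) T = w S T ^ a`, `w S (a • T) = …`
  have hne : ∀ S T, w S T ≠ 0 := fun S T h0 ↦ by
    have := hpow S T
    rw [h0, zero_pow hm0] at this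
    exact zero_ne_one this
  have hzero_left : ∀ T, w 0 T = 1 := fun T ↦ by
    have h := haddl 0 0 T
    rw [add_zero] at h
    exact (mul_eq_left₀ (hne 0 T)).mp h.symm
  have hzero_right : ∀ S, w S 0 = 1 := fun S ↦ by
    have h := haddr S 0 0
    rw [add_zero] at h
    exact (mul_eq_left₀ (hne S 0)).mp h.symm
  have hnsmul_left : ∀ (a : ℕ) S T, w (a • S) T = w S T ^ a := fun a S T ↦ by
    induction a with
    | zero => rw [zero_nsmul, pow_zero, hzero_left]
    | succ a ih => rw [succ_nsmul, haddl, ih, pow_succ]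
  have hnsmul_right : ∀ (a : ℕ) S T, w S (a • T) = w S T ^ a := fun a S T ↦ by
    induction a with
    | zero => rw [zero_nsmul, pow_zero, hzero_right]
    | succ a ih => rw [succ_nsmul, haddr, ih, pow_succ]
  -- the basis `P, Q` of `E[m]` given by the frame `e`, and coordinates of a torsion point
  obtain ⟨P, hPdef⟩ : ∃ P : geomTorsion W m, P = e.symm (Pi.single 0 1) := ⟨_, rfl⟩
  obtain ⟨Q, hQdef⟩ : ∃ Q : geomTorsion W m, Q = e.symm (Pi.single 1 1) := ⟨_, rfl⟩
  have heP : e P = Pi.single 0 1 := by rw [hPdef, e.apply_symm_apply]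
  have heQ : e Q = Pi.single 1 1 := by rw [hQdef, e.apply_symm_apply]
  have h01 : (0 : Fin 2) ≠ 1 := by decide
  have hdecomp : ∀ T : geomTorsion W m, T = (e T 0).val • P + (e T 1).val • Q := fun T ↦ by
    apply e.injective
    rw [map_add, map_nsmul, map_nsmul, heP, heQ]
    ext i
    fin_cases i
    · change e T 0 = ((e T 0).val • (Pi.single 0 1 : Fin 2 → ZMod m) +
        (e T 1).val • (Pi.single 1 1 : Fin 2 → ZMod m)) 0
      rw [Pi.add_apply, Pi.smul_apply, Pi.smul_apply, Pi.single_eq_same,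
        Pi.single_eq_of_ne h01, smul_zero, add_zero, nsmul_eq_mul, mul_one, ZMod.natCast_zmod_val]
    · change e T 1 = ((e T 0).val • (Pi.single 0 1 : Fin 2 → ZMod m) +
        (e T 1).val • (Pi.single 1 1 : Fin 2 → ZMod m)) 1
      rw [Pi.add_apply, Pi.smul_apply, Pi.smul_apply, Pi.single_eq_same,
        Pi.single_eq_of_ne h01.symm, smul_zero, zero_add, nsmul_eq_mul, mul_one,
        ZMod.natCast_zmod_val]
  -- `w Q P` is the inverse of `ζ = w P Q`, and the pairing in coordinates
  have hζinv : w P Q * w Q P = 1 := by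
    have h := halt (P + Q)
    rw [haddl, haddr, haddr, halt P, halt Q, one_mul, mul_one] at h
    exact h
  have hcoord : ∀ a b c d : ℕ,
      w (a • P + c • Q) (b • P + d • Q) * w P Q ^ (b * c) = w P Q ^ (a * d) := fun a b c d ↦ by
    rw [haddl, hnsmul_left, hnsmul_left, haddr, haddr, hnsmul_right, hnsmul_right, hnsmul_right,
      hnsmul_right, halt P, halt Q]
    simp only [one_pow, one_mul, mul_one, ← pow_mul]
    rw [mul_assoc, ← mul_pow, mul_comm (w Q P) (w P Q), hζinv, one_pow, mul_one, mul_comm d a]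
  -- `ζ` is a primitive `m`-th root of unity, by non-degeneracy
  have hfin : IsOfFinOrder (w P Q) :=
    isOfFinOrder_iff_pow_eq_one.mpr ⟨m, Nat.pos_of_ne_zero hm0, hpow P Q⟩
  have hordζ : orderOf (w P Q) = m := by
    refine Nat.dvd_antisymm (orderOf_dvd_of_pow_eq_one (hpow P Q)) ?_
    set d := orderOf (w P Q) with hd
    have hdQ : d • Q = 0 := hnd (d • Q) fun S ↦ by
      rw [hdecomp S, hnsmul_right, haddl, hnsmul_left, hnsmul_left, halt Q, one_pow, mul_one,
        ← pow_mul, mul_comm, pow_mul, pow_orderOf_eq_one, one_pow]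
    have h := congrArg (fun v : Fin 2 → ZMod m ↦ v 1) (map_nsmul e d Q)
    simp only [hdQ, map_zero, Pi.zero_apply, heQ, Pi.smul_apply, Pi.single_eq_same, nsmul_eq_mul,
      mul_one] at h
    exact (ZMod.natCast_eq_zero_iff d m).mp h.symm
  -- coordinates of `σ • P` and `σ • Q`
  have hσP : σ • P = (M 0 0).val • P + (M 1 0).val • Q := by
    have h := hdecomp (σ • P)
    rw [hM P, heP, Matrix.mulVec_single_one] at h
    exact h
  have hσQ : σ • Q = (M 0 1).val • P + (M 1 1).val • Q := by
    have h := hdecomp (σ • Q)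
    rw [hM Q, heQ, Matrix.mulVec_single_one] at h
    exact h
  -- Galois equivariance versus the cyclotomic character
  have hχ : σ • w P Q =
      w P Q ^ ((GaloisRepresentations.modNCyclotomicCharacter F m σ : (ZMod m)ˣ) : ZMod m).val :=
    GaloisRepresentations.modNCyclotomicCharacter_spec F m σ (w P Q) (hpow P Q)
  have hgalζ : σ • w P Q * w P Q ^ ((M 0 1).val * (M 1 0).val) =
      w P Q ^ ((M 0 0).val * (M 1 1).val) := by
    rw [hgal σ P Q, hσP, hσQ]
    exact hcoord _ _ _ _
  rw [hχ, ← pow_add, hfin.pow_eq_pow_iff_modEq, hordζ, ← ZMod.natCast_eq_natCast_iff] at hgalζ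
  push_cast at hgalζ
  simp only [ZMod.natCast_val, ZMod.cast_id', id_eq] at hgalζ
  rw [Matrix.det_fin_two, ← hgalζ]
  ring

/-! ### Reduction modulo `p` of the framed representation on `E[p^n]` -/

/-- **Compatibility of the framed representation on `E[p^n]` with `E[p] ⊂ E[p^n]`.** Let
`e : E[p^{k+1}] ≃ (ℤ/p^{k+1})²` be a frame with matrix representation `ρ`
(`e (σ P) = ρ(σ) · e P`). If the mod-`p` representation `Γ_F → Aut E[p]` is onto
(`WeierstrassCurve.HasSurjectiveModNGaloisRep W p`), then every `t ∈ GL₂(𝔽_p)` is the reduction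
modulo `p` of some `ρ(σ)`. Proof: `v ↦ e⁻¹(p^k ṽ)` (`ṽ` any lift of `v ∈ 𝔽_p²`) is an injection
`g : 𝔽_p² → E[p]`, hence a bijection (`#E[p] = p²`, `card_torsionPoints_eq_sq_holds`), with
`σ • g(v) = g((ρ(σ) mod p) · v)`; transporting `t` to `Aut E[p]` along `g` and lifting it to some
`σ` gives `ρ(σ) mod p = t` (Silverman, *AEC* III.7: `E[p] = p^k E[p^{k+1}]`). [folklore] -/
theorem exists_map_eq_of_hasSurjectiveModNGaloisRep {F : Type u} [Field F]
    (W : WeierstrassCurve F) [W.IsElliptic] (p k : ℕ) [Fact p.Prime] (hpF : (p : F) ≠ 0)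
    (e : geomTorsion W ((p ^ (k + 1) : ℕ) : ℤ) ≃+ (Fin 2 → ZMod (p ^ (k + 1))))
    (ρ : Field.absoluteGaloisGroup F →* GL (Fin 2) (ZMod (p ^ (k + 1))))
    (hρ : ∀ (σ : Field.absoluteGaloisGroup F) (P : geomTorsion W ((p ^ (k + 1) : ℕ) : ℤ)),
      e (σ • P) = ((ρ σ : GL (Fin 2) (ZMod (p ^ (k + 1)))) :
        Matrix (Fin 2) (Fin 2) (ZMod (p ^ (k + 1)))) *ᵥ e P)
    (hsurj : W.HasSurjectiveModNGaloisRep p) (t : GL (Fin 2) (ZMod p)) :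
    ∃ σ : Field.absoluteGaloisGroup F,
      Matrix.GeneralLinearGroup.map (ZMod.castHom (dvd_pow_self p k.succ_ne_zero) (ZMod p))
        (ρ σ) = t := by
  have hp : p.Prime := Fact.out
  haveI : NeZero (p ^ (k + 1)) := ⟨pow_ne_zero _ hp.ne_zero⟩
  set R := ZMod (p ^ (k + 1)) with hR
  set red : R →+* ZMod p := ZMod.castHom (dvd_pow_self p k.succ_ne_zero) (ZMod p) with hred
  -- `θ : ℤ/p → ℤ/p^(k+1)`, `x ↦ p^k x̃`
  set f : ℤ →+ R := (AddMonoidHom.mulLeft ((p : R) ^ k)).comp (Int.castAddHom R) with hf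
  have hf_apply : ∀ x : ℤ, f x = (p : R) ^ k * (x : R) := fun x ↦ rfl
  have hf0 : f (p : ℕ) = 0 := by
    rw [hf_apply, Int.cast_natCast, ← pow_succ,
      GaloisRepresentations.Serre1968.natCast_pow_eq_zero]
  set θ : ZMod p →+ R := ZMod.lift p ⟨f, hf0⟩ with hθ
  have hθred : ∀ b : R, θ (red b) = (p : R) ^ k * b := fun b ↦ by
    rw [hred, ZMod.castHom_apply, ZMod.cast_eq_val, ← Int.cast_natCast, hθ, ZMod.lift_coe]
    change f _ = _
    rw [hf_apply, Int.cast_natCast, ZMod.natCast_zmod_val]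
  have hθmul : ∀ (a : R) (x : ZMod p), a * θ x = θ (red a * x) := fun a x ↦ by
    obtain ⟨b, rfl⟩ := ZMod.ringHom_surjective red x
    rw [← map_mul, hθred, hθred]
    ring
  have hθp : ∀ x : ZMod p, p • θ x = 0 := fun x ↦ by
    obtain ⟨b, rfl⟩ := ZMod.ringHom_surjective red x
    rw [hθred, nsmul_eq_mul, ← mul_assoc, ← pow_succ',
      GaloisRepresentations.Serre1968.natCast_pow_eq_zero, zero_mul]
  have hθinj : ∀ x : ZMod p, θ x = 0 → x = 0 := fun x hx ↦ by
    obtain ⟨b, rfl⟩ := ZMod.ringHom_surjective red x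
    rw [hθred] at hx
    obtain ⟨b', rfl⟩ :=
      GaloisRepresentations.Serre1968.exists_eq_mul_of_pow_mul_eq_zero k.lt_succ_self b hx
    rw [map_mul, map_natCast, ZMod.natCast_self, zero_mul]
  -- the injection `g : 𝔽_p² → E[p]`, `v ↦ e⁻¹ (θ ∘ v)`
  set lift : (Fin 2 → ZMod p) → geomTorsion W ((p ^ (k + 1) : ℕ) : ℤ) :=
    fun v ↦ e.symm (fun i ↦ θ (v i)) with hlift
  have hlift_mem : ∀ v, ((lift v : geomTorsion W ((p ^ (k + 1) : ℕ) : ℤ)) : geomPoints W) ∈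
      geomTorsion W (p : ℤ) := fun v ↦ by
    rw [AddSubgroup.torsionBy.nsmul_iff, ← AddSubmonoidClass.coe_nsmul, hlift, ← map_nsmul]
    have : p • (fun i ↦ θ (v i)) = 0 := funext fun i ↦ by rw [Pi.smul_apply, hθp, Pi.zero_apply]
    rw [this, map_zero]
    rfl
  set g : (Fin 2 → ZMod p) →+ geomTorsion W (p : ℤ) :=
    { toFun := fun v ↦ ⟨_, hlift_mem v⟩
      map_zero' := by
        apply Subtype.ext
        change ((e.symm fun i ↦ θ ((0 : Fin 2 → ZMod p) i) :
          geomTorsion W ((p ^ (k + 1) : ℕ) : ℤ)) : geomPoints W) = 0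
        have : (fun i ↦ θ ((0 : Fin 2 → ZMod p) i)) = 0 := funext fun i ↦ by
          rw [Pi.zero_apply, map_zero, Pi.zero_apply]
        rw [this, map_zero]
        rfl
      map_add' := fun v w ↦ by
        apply Subtype.ext
        change ((e.symm fun i ↦ θ ((v + w) i) : geomTorsion W ((p ^ (k + 1) : ℕ) : ℤ)) :
            geomPoints W) =
          ((e.symm fun i ↦ θ (v i) : geomTorsion W ((p ^ (k + 1) : ℕ) : ℤ)) : geomPoints W) +
            ((e.symm fun i ↦ θ (w i) : geomTorsion W ((p ^ (k + 1) : ℕ) : ℤ)) : geomPoints W)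
        have : (fun i ↦ θ ((v + w) i)) = (fun i ↦ θ (v i)) + fun i ↦ θ (w i) :=
          funext fun i ↦ by rw [Pi.add_apply, map_add, Pi.add_apply]
        rw [this, map_add, AddSubgroup.coe_add] } with hg
  have hg_coe : ∀ v, ((g v : geomTorsion W (p : ℤ)) : geomPoints W) = (lift v : geomPoints W) :=
    fun v ↦ rfl
  have hginj : Function.Injective g := by
    refine (injective_iff_map_eq_zero g).mpr fun v hv ↦ ?_
    have h1 : ((lift v : geomTorsion W ((p ^ (k + 1) : ℕ) : ℤ)) : geomPoints W) = 0 := by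
      rw [← hg_coe, hv]; rfl
    have h2 : lift v = 0 := by exact_mod_cast h1
    rw [hlift, ← map_zero e.symm] at h2
    have h3 := e.symm.injective h2
    funext i
    exact hθinj _ (congrFun h3 i)
  -- `g` is a bijection, `#E[p] = p²`
  have hpF' : ((p : ℕ) : AlgebraicClosure F) ≠ 0 := fun h0 ↦ hpF <| by
    apply (algebraMap F (AlgebraicClosure F)).injective
    rw [map_natCast, map_zero, h0]
  have hcard1 : Nat.card (geomTorsion W (p : ℤ)) = p ^ 2 :=
    card_torsionPoints_eq_sq_holds W (AlgebraicClosure F) hpF'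
  haveI : Finite (geomTorsion W (p : ℤ)) :=
    Nat.finite_of_card_ne_zero (by rw [hcard1]; exact pow_ne_zero _ hp.ne_zero)
  have hbij : Function.Bijective g := hginj.bijective_of_nat_card_le (by
    rw [hcard1, Nat.card_fun, Nat.card_zmod, Nat.card_eq_fintype_card, Fintype.card_fin])
  set gE : (Fin 2 → ZMod p) ≃+ geomTorsion W (p : ℤ) := AddEquiv.ofBijective g hbij with hgE
  -- equivariance: `σ • g v = g ((ρ σ mod p) v)`
  have hequiv : ∀ (σ : Field.absoluteGaloisGroup F) (v : Fin 2 → ZMod p),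
      σ • g v = g (((Matrix.GeneralLinearGroup.map red (ρ σ) : GL (Fin 2) (ZMod p)) :
        Matrix (Fin 2) (Fin 2) (ZMod p)) *ᵥ v) := by
    intro σ v
    apply Subtype.ext
    rw [AddSubgroup.torsionBy.coe_smul, hg_coe, hg_coe, ← AddSubgroup.torsionBy.coe_smul]
    have h1 : σ • lift v = e.symm (((ρ σ : GL (Fin 2) R) : Matrix (Fin 2) (Fin 2) R) *ᵥ
        fun i ↦ θ (v i)) := by
      have := congrArg e.symm (hρ σ (lift v))
      rwa [e.symm_apply_apply, hlift, e.apply_symm_apply] at this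
    have h2 : (((ρ σ : GL (Fin 2) R) : Matrix (Fin 2) (Fin 2) R) *ᵥ fun i ↦ θ (v i)) =
        fun i ↦ θ ((((Matrix.GeneralLinearGroup.map red (ρ σ) : GL (Fin 2) (ZMod p)) :
          Matrix (Fin 2) (Fin 2) (ZMod p)) *ᵥ v) i) := by
      have hmap : ∀ i j, ((Matrix.GeneralLinearGroup.map red (ρ σ) : GL (Fin 2) (ZMod p)) :
          Matrix (Fin 2) (Fin 2) (ZMod p)) i j = red (((ρ σ : GL (Fin 2) R) :
            Matrix (Fin 2) (Fin 2) R) i j) := fun i j ↦ rfl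
      funext i
      simp only [Matrix.mulVec, dotProduct, Fin.sum_univ_two, map_add, hmap, ← hθmul]
    rw [h1, h2]
  -- transport `t` to an automorphism of `E[p]` and lift it to `Γ_F`
  set tE : (Fin 2 → ZMod p) ≃+ (Fin 2 → ZMod p) :=
    { toFun := fun v ↦ (t : Matrix (Fin 2) (Fin 2) (ZMod p)) *ᵥ v
      invFun := fun v ↦ ((t⁻¹ : GL (Fin 2) (ZMod p)) : Matrix (Fin 2) (Fin 2) (ZMod p)) *ᵥ v
      left_inv := fun v ↦ by
        change ((t⁻¹ : GL (Fin 2) (ZMod p)) : Matrix (Fin 2) (Fin 2) (ZMod p)) *ᵥ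
          ((t : Matrix (Fin 2) (Fin 2) (ZMod p)) *ᵥ v) = v
        rw [Matrix.mulVec_mulVec, ← Matrix.GeneralLinearGroup.coe_mul, inv_mul_cancel,
          Matrix.GeneralLinearGroup.coe_one, Matrix.one_mulVec]
      right_inv := fun v ↦ by
        change (t : Matrix (Fin 2) (Fin 2) (ZMod p)) *ᵥ
          (((t⁻¹ : GL (Fin 2) (ZMod p)) : Matrix (Fin 2) (Fin 2) (ZMod p)) *ᵥ v) = v
        rw [Matrix.mulVec_mulVec, ← Matrix.GeneralLinearGroup.coe_mul, mul_inv_cancel,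
          Matrix.GeneralLinearGroup.coe_one, Matrix.one_mulVec]
      map_add' := fun v w ↦ Matrix.mulVec_add _ _ _ } with htE
  set ft : geomTorsion W (p : ℤ) ≃+ geomTorsion W (p : ℤ) := (gE.symm.trans tE).trans gE with hft
  obtain ⟨σ, hσ⟩ := hsurj (Multiplicative.ofAdd ft)
  have hσP : ∀ P : geomTorsion W (p : ℤ), σ • P = ft P := fun P ↦ by
    rw [← galoisRepTorsion_apply W p σ P, hσ]
    rfl
  refine ⟨σ, Units.ext (Matrix.ext fun i j ↦ ?_)⟩
  have hv : ∀ v : Fin 2 → ZMod p,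
      ((Matrix.GeneralLinearGroup.map red (ρ σ) : GL (Fin 2) (ZMod p)) :
        Matrix (Fin 2) (Fin 2) (ZMod p)) *ᵥ v = (t : Matrix (Fin 2) (Fin 2) (ZMod p)) *ᵥ v := by
    intro v
    apply hginj
    rw [← hequiv, hσP, hft, AddEquiv.trans_apply, AddEquiv.trans_apply]
    have hgv : g v = gE v := (AddEquiv.ofBijective_apply g hbij v).symm
    rw [hgv, AddEquiv.symm_apply_apply]
    rfl
  have := congrFun (hv (Pi.single j 1)) i
  rwa [Matrix.mulVec_single_one, Matrix.mulVec_single_one] at this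

/-! ### Serre's lifting lemma for the image of Galois: the discharge -/

/-- **Discharge of `serre_hasSurjectiveModNGaloisRep_pow`** (J.-P. Serre, *Abelian `ℓ`-adic
representations and elliptic curves* (1968), Ch. IV §3.4, Lemma 3 and its application to
`ρ_{E,p}`; quoted in the fact's docstring from Dokchitser–Dokchitser, Math. Z. 272 (2012),
Introduction): for an elliptic curve `W/ℚ` and a prime `p ≥ 5`, if `ρ̄_{E,p} : Γ_ℚ → Aut(E[p])`
is onto then so is `ρ̄_{E,p^n} : Γ_ℚ → Aut(E[p^n])` for every `n`. Proof: for `n = 0`,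
`E[1] = 0`. For `n = k + 1`: frame `E[p^n] ≅ (ℤ/p^n)²` (`nonempty_addEquiv_geomTorsion`, from
`#E[m] = m²`), giving `ρ : Γ_ℚ → GL₂(ℤ/p^n)` (`exists_rep_of_addEquiv`); its image `H` maps onto
`GL₂(𝔽_p)` (`exists_map_eq_of_hasSurjectiveModNGaloisRep`) and `det H = (ℤ/p^n)ˣ` because
`det ρ = χ_{p^n}` (Weil pairing, `det_eq_modNCyclotomicCharacter`) is onto over `ℚ`
(`modNCyclotomicCharacter_rat_surjective`); hence `H = GL₂(ℤ/p^n)` by Serre's lemma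
(`Serre1968.generalLinearGroup_eq_top_of_map_surjective`, `p ≥ 5`), and every additive
automorphism of `E[p^n]`, having an invertible matrix, is some `σ`.
[cite: SerreAbelianLadic1968, Ch. IV §3.4, Lemma 3] -/
theorem serre_hasSurjectiveModNGaloisRep_pow_holds : serre_hasSurjectiveModNGaloisRep_pow := by
  intro W _ p _ hp5 hsurj n
  have hp : p.Prime := Fact.out
  cases n with
  | zero =>
    haveI : Subsingleton (geomTorsion W ((p ^ 0 : ℕ) : ℤ)) := ⟨fun a b ↦ by
      have ha := AddSubgroup.torsionBy.nsmul_iff.mp a.2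
      have hb := AddSubgroup.torsionBy.nsmul_iff.mp b.2
      simp only [pow_zero, one_smul] at ha hb
      exact Subtype.ext (ha.trans hb.symm)⟩
    intro y
    exact ⟨1, Multiplicative.toAdd.injective (AddEquiv.ext fun a ↦ Subsingleton.elim _ _)⟩
  | succ k =>
    have hpQ : (p : ℚ) ≠ 0 := Nat.cast_ne_zero.mpr hp.ne_zero
    obtain ⟨e⟩ := nonempty_addEquiv_geomTorsion W p (k + 1) k.succ_pos hpQ
    obtain ⟨ρ, hρ⟩ := exists_rep_of_addEquiv W e
    haveI : NeZero (p ^ (k + 1)) := ⟨pow_ne_zero _ hp.ne_zero⟩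
    -- Serre: the image of `ρ` is all of `GL₂(ℤ/p^(k+1))`
    have htop : ρ.range = ⊤ := by
      refine GaloisRepresentations.Serre1968.generalLinearGroup_eq_top_of_map_surjective hp5
        k.succ_ne_zero ρ.range (fun t ↦ ?_) (fun u ↦ ?_)
      · obtain ⟨σ, hσ⟩ := exists_map_eq_of_hasSurjectiveModNGaloisRep W p k hpQ e ρ hρ hsurj t
        exact ⟨ρ σ, ⟨σ, rfl⟩, hσ⟩
      · obtain ⟨σ, hσ⟩ :=
          GaloisRepresentations.modNCyclotomicCharacter_rat_surjective (p ^ (k + 1)) u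
        refine ⟨ρ σ, ⟨σ, rfl⟩, Units.ext ?_⟩
        rw [Matrix.GeneralLinearGroup.val_det_apply, ← hσ]
        exact det_eq_modNCyclotomicCharacter W (p ^ (k + 1))
          (hp.two_le.trans (Nat.le_self_pow k.succ_ne_zero p)) e σ _ (hρ σ)
    -- every additive automorphism of `E[p^(k+1)]` has an invertible matrix, hence is some `σ`
    intro y
    obtain ⟨Φ, hΦ⟩ := exists_matrix_of_addEquiv e
    obtain ⟨B, hB⟩ := exists_generalLinearGroup_of_addEquiv Φ (Multiplicative.toAdd y)
    obtain ⟨σ, hσ⟩ : B ∈ ρ.range := htop ▸ Subgroup.mem_top B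
    refine ⟨σ, Multiplicative.toAdd.injective (AddEquiv.ext fun P ↦ e.injective ?_)⟩
    rw [galoisRepTorsion_apply, hρ σ P, hσ, hB]
    exact (hΦ _ P).symm

end Literature.NumberTheory.EllipticCurves
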